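import Summits.HodgeConjecture.HodgeConjecture.Theorems.SignSymmetricPowersFourFactsKeyed
import Summits.HodgeConjecture.HodgeConjecture.Theorems.SmoothHypersurfaceGeometricGenus
import Literature.AlgebraicGeometry.HodgeTheory.PicardLefschetzOneNodeOfMonomial
import HarnessLib

/-!
# Crux K1-B `VeryGeneralSignCommutatorsInHg` and the rung leaf modulo {hCDK, hN} ONLY — both Picard–Lefschetz binders discharged
# BY NAME (route `SignSymmetricPowers`, item stmt-HodgeConjecture-19716)

Prover seat `hodge-nonav-20241-p1` (g18), cell `hodge-nonav`; helper `--supports stmt-HodgeConjecture-19716`; sorry-free, no definition, no new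
named fact. The KEYED composition `SignSymmetricPowersFourFactsKeyed.veryGeneralSignCommutatorsInHg_of_genusBound_three_facts_keyed`
(seat `hodge-nonav-19716-p2` g10: K1-B ⟸ {hpg3, hPL₁, hPL₂exch, hCDK, hN}) fed the THEOREMS
`picardLefschetz_oneNode_holds` (hPL₁ in every pencil direction: prover-Bx's monomial theorem `NodalPencil.picardLefschetz_oneNode_monomial` + the
direction homotopy of `PicardLefschetzOneNodeOfMonomial`), `picardLefschetz_exchangedPair_holds` (hPL₂exch ⟸ hPL₁ by two commuting one-node meridians,
`PicardLefschetzExchangedPairOfOneNode`) and the landed genus bound `SmoothHypersurfaceGeometricGenus.stub_genusBoundThreefold` (hpg3):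

* `stub_picardLefschetzExchangedPair` — the registered stub of skeleton v24, CLOSED by name (`picardLefschetz_exchangedPair_holds`);
* `veryGeneralSignCommutatorsInHg_of_two_facts (hCDK) (hNC)` — **K1-B ⟸ {hCDK, hN}** (registry v25's composition, by-name variant;
  the `_pair`-chain variant of seat 19716-p2 is equivalent);
* `signThreefoldPowersHodge_of_two_facts (hCDK) (hNC)` — the rung leaf `SignThreefoldPowersHodge` ⟸ {hCDK, hN}.

hCDK = `cmsp_nonHodgeGenericPoints_countable_algebraic_cover` (Cattani–Deligne–Kaplan 1995 in the CMSP §15.3 form; print input, shared with route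
A); hN = the symmetric-`A₃` non-commutation clause (`SymmetricA3NonCommutation`; prover-Bx's programme A₃-TRACE). CONDITIONAL; nothing here says
HC ∕ HC_AV is proved; rung F-H1 not moved.

## References

* [VoisinHodgeII2003] C. Voisin, Hodge Theory and Complex Algebraic Geometry II, CUP 2003, §3.2.1 Thm. 3.16, §6.1.3 Cor. 6.12.
* [CattaniDeligneKaplan1995] E. Cattani, P. Deligne, A. Kaplan, On the locus of Hodge classes, JAMS 8 (1995), Thm. 1.1, Cor. 1.2.
* [Arapura2012] D. Arapura, Algebraic Geometry over the Complex Numbers, §17.3 (17.3.1).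
-/

noncomputable section

set_option linter.dupNamespace false

namespace Summit.HodgeConjecture.HodgeConjecture.Theorems.SignSymmetricPowersTwoFacts

open Literature.AlgebraicGeometry.HodgeTheory
open Summit.HodgeConjecture.HodgeConjecture.Theorems

/-- **The registered stub `stub_picardLefschetzExchangedPair` of crux K1-B (skeleton v24) is CLOSED**: the exchanged-pair Picard–Lefschetz
binder `picardLefschetz_exchangedPair` is the theorem `picardLefschetz_exchangedPair_holds` (`PicardLefschetzOneNodeOfMonomial`: hPL₂exch ⟸ hPL₁ by
two commuting one-node meridians, hPL₁ in every direction from prover-Bx's monomial theorem by a direction homotopy).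
[cite: VoisinHodgeII2003, §3.2.1 Thm. 3.16, Cor. 3.17, Rem. 3.21 and §2.3.2] -/
theorem stub_picardLefschetzExchangedPair : Literature.AlgebraicGeometry.HodgeTheory.picardLefschetz_exchangedPair :=
  picardLefschetz_exchangedPair_holds

/-- **Crux K1-B `VeryGeneralSignCommutatorsInHg` modulo {hCDK, hNC}** — the keyed five-fact composition with hpg3, hPL₁, hPL₂exch supplied by the
tree theorems `stub_genusBoundThreefold`, `picardLefschetz_oneNode_holds`, `picardLefschetz_exchangedPair_holds`. CONDITIONAL on the
Cattani–Deligne–Kaplan cover and the `A₃` non-commutation; nothing here says HC ∕ HC_AV is proved.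
[cite: VoisinHodgeII2003, §3.2.1 Thm. 3.16 and §6.1.3 Cor. 6.12] [cite: CattaniDeligneKaplan1995, Thm. 1.1 and Cor. 1.2] -/
theorem veryGeneralSignCommutatorsInHg_of_two_facts
    (hCDK : Literature.AlgebraicGeometry.HodgeTheory.cmsp_nonHodgeGenericPoints_countable_algebraic_cover)
    (hNC : ∀ (n d : ℕ) (f₁ g₀ g₂ : MvPolynomial (Fin (n + 2)) ℂ) (j k : Fin (n + 2)) (a : Fin (n + 2) → ℂˣ),
      1 ≤ n → 1 ≤ d → f₁.IsHomogeneous d → g₀.IsHomogeneous d → g₂.IsHomogeneous d → Literature.AlgebraicGeometry.HodgeTheory.IsSymmetricA3Datum f₁ g₀ g₂ j k a →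
      ∀ (εa εb : ℝ) (ψ : ℂ → ℂ), Literature.AlgebraicGeometry.HodgeTheory.IsSymmetricA3Bifurcation f₁ g₀ g₂ j a εa εb ψ →
        ∃ εa' : ℝ, 0 < εa' ∧ εa' ≤ εa ∧ Literature.AlgebraicGeometry.HodgeTheory.SymmetricA3NonCommutation n d f₁ g₀ g₂ ψ εa') :
    Summit.HodgeConjecture.HodgeConjecture.Theses.SignSymmetricPowers.VeryGeneralSignCommutatorsInHg :=
  SignSymmetricPowersFourFactsKeyed.veryGeneralSignCommutatorsInHg_of_genusBound_three_facts_keyed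
    SmoothHypersurfaceGeometricGenus.stub_genusBoundThreefold @picardLefschetz_oneNode_holds @picardLefschetz_exchangedPair_holds
    @hCDK @hNC

/-- **The rung leaf `SignThreefoldPowersHodge` modulo {hCDK, hNC}** (composition with the landed
`signThreefoldPowersHodge_of_veryGeneralSignCommutatorsInHg`). CONDITIONAL; rung F-H1 not moved; nothing here says HC ∕ HC_AV is proved.
[cite: CattaniDeligneKaplan1995, Thm. 1.1 and Cor. 1.2] [cite: Arapura2012, §17.3 (17.3.1)] -/
theorem signThreefoldPowersHodge_of_two_facts
    (hCDK : Literature.AlgebraicGeometry.HodgeTheory.cmsp_nonHodgeGenericPoints_countable_algebraic_cover)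
    (hNC : ∀ (n d : ℕ) (f₁ g₀ g₂ : MvPolynomial (Fin (n + 2)) ℂ) (j k : Fin (n + 2)) (a : Fin (n + 2) → ℂˣ),
      1 ≤ n → 1 ≤ d → f₁.IsHomogeneous d → g₀.IsHomogeneous d → g₂.IsHomogeneous d → Literature.AlgebraicGeometry.HodgeTheory.IsSymmetricA3Datum f₁ g₀ g₂ j k a →
      ∀ (εa εb : ℝ) (ψ : ℂ → ℂ), Literature.AlgebraicGeometry.HodgeTheory.IsSymmetricA3Bifurcation f₁ g₀ g₂ j a εa εb ψ →
        ∃ εa' : ℝ, 0 < εa' ∧ εa' ≤ εa ∧ Literature.AlgebraicGeometry.HodgeTheory.SymmetricA3NonCommutation n d f₁ g₀ g₂ ψ εa') :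
    Summit.HodgeConjecture.HodgeConjecture.Theses.SignSymmetricPowers.SignThreefoldPowersHodge :=
  SignSymmetricPowersSignThreefoldPowersHodge.signThreefoldPowersHodge_of_veryGeneralSignCommutatorsInHg
    (veryGeneralSignCommutatorsInHg_of_two_facts @hCDK @hNC)

end Summit.HodgeConjecture.HodgeConjecture.Theorems.SignSymmetricPowersTwoFacts

end
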